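import Mathlib.FieldTheory.Galois.Infinite
import Mathlib.FieldTheory.IsAlgClosed.Basic
import Literature.AnabelianGeometry.EtaleTheta.KummerKernel
import Literature.AnabelianGeometry.AbsoluteAnabelian.AbsTopIII.KummerFaithful
import HarnessLib

/-!
# L-LANA objects XII quater: the Kummer embedding `K^× ↪ H¹(Π, Λ(Ω^×))` in an AMBIENT algebraically closed field (LANA §4.2 (b))

Record-only file (D-0012) of the abc-iut cell (seat abc-iut-c312-4, L-LANA level, plan/LLANA-SPEC N5/N9/N13);
TAKES NO SIDE on [IUTchIII] Cor. 3.12. LANA §4.2 (b) p. 26 (objects reconstructed from `Π_v`): "• The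
topological field `K̄_v` with the natural continuous action of `Π_v`. • The embedding
`K_v^× = (K̄_v^×)^{G_v} ↪ H¹(Π_v, Λ(O^×_v))` by Kummer theory." The siblings `LanaKummer*.lean` realise this over
the CONSTRUCTED closure `K̄_v := AlgCl K_v = AlgebraicClosure K_v` of an abstract complete field `K_v`. The tree's
tempered curves, however (layer L3, `SemiGraphs.TemperedCurve`: base field `K ⊆ ℚ̄_p` an intermediate field of
`ℚ̄_p/ℚ_p`, augmentation `Π^temp_X → G_{ℚ_p}` with image `G_K = K.fixingSubgroup`), live in a FIXED ambient
closure. This file redoes the construction in that generality — Mathlib + L2-t3's Kummer class only: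

* ambient data: a Galois extension `Ω/k` with `Ω` algebraically closed, an intermediate field `K`
  (`G_K := K.fixingSubgroup ≤ Gal(Ω/k)`), and ANY group `Π` with a homomorphism `ρ : Π → Gal(Ω/k)`; `Π` acts
  on `Ω^×` through `ρ` (`ViaUnits ρ`, rootable because `Ω` is algebraically closed);
* `mem_invariants_viaUnits_iff_mem` — if `ρ(Π) = G_K` then **`(Ω^×)^{Π} = K^×`** (infinite Galois theory:
  `fixedField (fixingSubgroup K) = K`, Mathlib `InfiniteGalois.fixedField_fixingSubgroup`); the inclusion
  `K^× ⊆ (Ω^×)^{Π}` needs only `ρ(Π) ≤ G_K` (`unitsToInvariants`);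
* `kummerVia ρ : (Ω^×)^{Π} → H¹(Π, Λ(Ω^×))` (L2-t3 `kummerMapFixed`) and the printed composite
  **`kummerEmbedding ρ : K^× → H¹(Π, Λ(Ω^×))`**;
* **injectivity** (`kummerVia_injective_of`, `kummerEmbedding_injective_of`) for `ρ(Π) = G_K` under
  `⋂_n (K^×)^n = 1` ([AbsTopIII] Def. 1.5 (a), seat abc-iut-L4's `DivisibleElementsTrivial Kˣ`), by L2-t3's
  kernel criterion (`kummerMapFixed_injective_of_iInter_pow_eq_bot`).

The bad-place instance over the tree's tempered curves (`Ω = ℚ̄_p`, `Π = Π^temp_X`, `ρ = ` the augmentation,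
`⋂_n (K^×)^n = 1` DISCHARGED by L4's `isTorallyKummerFaithful_padic`) is the sibling `LanaKummerTempered.lean`.
Modelling notes as in `LanaKummer.lean`: coefficients `Λ(O^×) = Λ(Ω^×)`; Mathlib's discrete `groupCohomology.H1`.
[cite: LANA2026Report, §4.2 (b) p. 26, §3.8 (a) p. 20, §6.1 p. 31] NOT here: any judgement.
-/

noncomputable section

namespace Summit.ABC
namespace IUTFork
namespace Ambient

open Literature.AnabelianGeometry.EtaleTheta
open Literature.AnabelianGeometry.AbsoluteAnabelian.AbsTopIII (DivisibleElementsTrivial)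

section Via

variable {k Ω : Type} [Field k] [Field Ω] [Algebra k Ω]
variable {P : Type} [Group P] (ρ : P →* (Ω ≃ₐ[k] Ω))

/-- **`Ω^×` as a `Π`-group through `ρ : Π → Gal(Ω/k)`** ("`K̄_v` with the natural continuous action of `Π_v`",
on units): a type synonym of `Ωˣ` with `g • u := ρ(g)(u)`. [cite: LANA2026Report, §4.2 (b) p. 26] -/
def ViaUnits (_ρ : P →* (Ω ≃ₐ[k] Ω)) : Type := Ωˣ

/-- `Ω^×` (through `ρ`) is a commutative group. [cite: LANA2026Report, §4.2 (b) p. 26] -/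
instance ViaUnits.instCommGroup : CommGroup (ViaUnits ρ) := inferInstanceAs (CommGroup Ωˣ)

/-- **`Π ↷ Ω^×` through `ρ`** (Mathlib's action of `Gal(Ω/k)` on `Ωˣ`, pulled back along `ρ`).
[cite: LANA2026Report, §4.2 (b) p. 26] -/
instance ViaUnits.instAction : MulDistribMulAction P (ViaUnits ρ) := MulDistribMulAction.compHom Ωˣ ρ

/-- The identification `Ω^× = Ω^×` (forgetting through which group one acts). [cite: LANA2026Report, §4.2 (b) p. 26] -/
def ViaUnits.of : Ωˣ ≃* ViaUnits ρ := MulEquiv.refl _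

/-- The action through `ρ`, computed on underlying field elements: `g • u = ρ(g)(u)`.
[cite: LANA2026Report, §4.2 (b) p. 26] -/
@[simp] theorem ViaUnits.coe_smul (g : P) (u : ViaUnits ρ) :
    (((ViaUnits.of ρ).symm (g • u) : Ωˣ) : Ω) = ρ g (((ViaUnits.of ρ).symm u : Ωˣ) : Ω) := rfl

variable [IsAlgClosed Ω]

/-- **Hypothesis (a) of LANA §6.1: `Ω^×` is rootable** (`Ω` algebraically closed: every unit has an `n`-th root
for every `n ≥ 1`, Mathlib `IsAlgClosed.exists_pow_nat_eq`). [cite: LANA2026Report, §6.1 (a) p. 31] -/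
instance ViaUnits.instRootableBy : RootableBy (ViaUnits ρ) ℕ where
  root u n := if hn : n = 0 then 1 else
    ViaUnits.of ρ (Units.mk0
      (Classical.choose (IsAlgClosed.exists_pow_nat_eq (((ViaUnits.of ρ).symm u : Ωˣ) : Ω) (Nat.pos_of_ne_zero hn)))
      (by
        intro h0
        have h := Classical.choose_spec
          (IsAlgClosed.exists_pow_nat_eq (((ViaUnits.of ρ).symm u : Ωˣ) : Ω) (Nat.pos_of_ne_zero hn))
        rw [h0, zero_pow hn] at h
        exact ((ViaUnits.of ρ).symm u).ne_zero h.symm))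
  root_zero u := by simp
  root_cancel {n} u hn := by
    simp only [hn, ↓reduceDIte]
    apply (ViaUnits.of ρ).symm.injective
    ext
    rw [map_pow, MulEquiv.symm_apply_apply, Units.val_pow_eq_pow_val, Units.val_mk0]
    exact Classical.choose_spec
      (IsAlgClosed.exists_pow_nat_eq (((ViaUnits.of ρ).symm u : Ωˣ) : Ω) (Nat.pos_of_ne_zero hn))

omit [IsAlgClosed Ω] in
/-- `Π`-invariance of a unit is invariance of its underlying element under `ρ(Π)`.
[cite: LANA2026Report, §4.2 (b) p. 26] -/
theorem mem_invariants_viaUnits_iff (u : ViaUnits ρ) :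
    u ∈ invariants (A := ViaUnits ρ) (⊤ : Subgroup P) ↔
      ∀ g : P, ρ g (((ViaUnits.of ρ).symm u : Ωˣ) : Ω) = (((ViaUnits.of ρ).symm u : Ωˣ) : Ω) := by
  rw [invariants, FixedPoints.mem_subgroup]
  constructor
  · intro h g
    have hg : g • u = u := h ⟨g, trivial⟩
    have hg' := congrArg (fun x : ViaUnits ρ => (((ViaUnits.of ρ).symm x : Ωˣ) : Ω)) hg
    rwa [ViaUnits.coe_smul] at hg'
  · intro h g
    change (g : P) • u = u
    apply (ViaUnits.of ρ).symm.injective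
    exact Units.ext (h g)

end Via

section Field

variable {k Ω : Type} [Field k] [Field Ω] [Algebra k Ω]
variable {P : Type} [Group P] (ρ : P →* (Ω ≃ₐ[k] Ω)) (K : IntermediateField k Ω)

/-- **`K^× ⊆ (Ω^×)^{Π}`** as soon as `ρ(Π) ≤ G_K = K.fixingSubgroup`: the inclusion `K^× → (Ω^×)^{Π}`, `x ↦ x`.
[cite: LANA2026Report, §4.2 (b) p. 26] -/
def unitsToInvariants (hρ : ρ.range ≤ K.fixingSubgroup) :
    (↥K)ˣ →* invariants (A := ViaUnits ρ) (⊤ : Subgroup P) where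
  toFun x := ⟨ViaUnits.of ρ (Units.map (algebraMap (↥K) Ω : ↥K →* Ω) x),
    (mem_invariants_viaUnits_iff ρ _).mpr fun g =>
      (IntermediateField.mem_fixingSubgroup_iff K _).mp (hρ ⟨g, rfl⟩) _ (x : ↥K).2⟩
  map_one' := Subtype.ext (by simp)
  map_mul' x y := Subtype.ext (by simp)

/-- Underlying element: `unitsToInvariants x = x ∈ Ω`. [cite: LANA2026Report, §4.2 (b) p. 26] -/
@[simp] theorem coe_unitsToInvariants (hρ : ρ.range ≤ K.fixingSubgroup) (x : (↥K)ˣ) :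
    (((ViaUnits.of ρ).symm (unitsToInvariants ρ K hρ x : invariants (A := ViaUnits ρ) ⊤) : Ωˣ) : Ω) =
      ((x : ↥K) : Ω) := rfl

/-- `K^× → (Ω^×)^{Π}` is injective. [cite: LANA2026Report, §4.2 (b) p. 26] -/
theorem unitsToInvariants_injective (hρ : ρ.range ≤ K.fixingSubgroup) :
    Function.Injective (unitsToInvariants ρ K hρ) := by
  intro x y h
  have h' := congrArg
    (fun a : invariants (A := ViaUnits ρ) (⊤ : Subgroup P) => (((ViaUnits.of ρ).symm a : Ωˣ) : Ω)) h
  simp only [coe_unitsToInvariants] at h'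
  exact Units.ext (Subtype.ext h')

variable [IsGalois k Ω]

/-- **`(Ω^×)^{Π} = K^×` when `ρ(Π) = G_K`** (infinite Galois theory: an element of `Ω` fixed by `G_K` lies in
`fixedField(G_K) = K`, Mathlib `InfiniteGalois.fixedField_fixingSubgroup`). [cite: LANA2026Report, §4.2 (b) p. 26] -/
theorem mem_invariants_viaUnits_iff_mem (hρ : ρ.range = K.fixingSubgroup) (u : ViaUnits ρ) :
    u ∈ invariants (A := ViaUnits ρ) (⊤ : Subgroup P) ↔ (((ViaUnits.of ρ).symm u : Ωˣ) : Ω) ∈ K := by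
  rw [mem_invariants_viaUnits_iff]
  constructor
  · intro h
    rw [← InfiniteGalois.fixedField_fixingSubgroup K, IntermediateField.mem_fixedField_iff]
    intro σ hσ
    rw [← hρ] at hσ
    obtain ⟨g, rfl⟩ := hσ
    exact h g
  · intro h g
    exact (IntermediateField.mem_fixingSubgroup_iff K _).mp (hρ.le ⟨g, rfl⟩) _ h

/-- … so `K^× → (Ω^×)^{Π}` is surjective when `ρ(Π) = G_K`. [cite: LANA2026Report, §4.2 (b) p. 26] -/
theorem unitsToInvariants_surjective (hρ : ρ.range = K.fixingSubgroup) :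
    Function.Surjective (unitsToInvariants ρ K hρ.le) := by
  intro a
  have ha : (((ViaUnits.of ρ).symm (a : ViaUnits ρ) : Ωˣ) : Ω) ∈ K :=
    (mem_invariants_viaUnits_iff_mem ρ K hρ _).mp a.2
  have hne : (⟨_, ha⟩ : ↥K) ≠ 0 := by
    intro h0
    have h0' := congrArg (fun x : ↥K => (x : Ω)) h0
    exact ((ViaUnits.of ρ).symm (a : ViaUnits ρ)).ne_zero h0'
  refine ⟨Units.mk0 _ hne, Subtype.ext ((ViaUnits.of ρ).symm.injective (Units.ext ?_))⟩
  rfl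

/-- **"`K_v^× = (K̄_v^×)^{G_v}`" at the level of `Π`** (`ρ(Π) = G_K`): `K^× ≃ (Ω^×)^{Π}` as a group isomorphism.
[cite: LANA2026Report, §4.2 (b) p. 26] -/
def unitsEquivInvariants (hρ : ρ.range = K.fixingSubgroup) :
    (↥K)ˣ ≃* invariants (A := ViaUnits ρ) (⊤ : Subgroup P) :=
  MulEquiv.ofBijective (unitsToInvariants ρ K hρ.le)
    ⟨unitsToInvariants_injective ρ K hρ.le, unitsToInvariants_surjective ρ K hρ⟩

end Field

section Kummer

variable {k Ω : Type} [Field k] [Field Ω] [Algebra k Ω] [IsAlgClosed Ω]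
variable {P : Type} [Group P] (ρ : P →* (Ω ≃ₐ[k] Ω)) (K : IntermediateField k Ω)

/-- **The Kummer map `(Ω^×)^{Π} → H¹(Π, Λ(Ω^×))`**, `Π` acting through `ρ` (L2-t3 `kummerMapFixed` at level `⊤`;
LANA §6.1 "`M^H → (M^{gp})^H → H¹(H, Λ(M))`"). [cite: LANA2026Report, §6.1 p. 31, §4.2 (b) p. 26] -/
def kummerVia :
    Additive (invariants (A := ViaUnits ρ) (⊤ : Subgroup P)) →+
      groupCohomology.H1 (cyclotomeRep (A := ViaUnits ρ) (⊤ : Subgroup P)) :=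
  kummerMapFixed ⊤

/-- **LANA §4.2 (b), second bullet, in the ambient closure: "the embedding
`K_v^× = (K̄_v^×)^{G_v} ↪ H¹(Π_v, Λ(O^×_v))` by Kummer theory"** — for `ρ(Π) ≤ G_K`, the composite
`K^× → (Ω^×)^{Π} → H¹(Π, Λ(Ω^×))` (injective for `ρ(Π) = G_K` under `⋂_n (K^×)^n = 1`:
`kummerEmbedding_injective_of`). [cite: LANA2026Report, §4.2 (b) p. 26] -/
def kummerEmbedding (hρ : ρ.range ≤ K.fixingSubgroup) :
    Additive (↥K)ˣ →+ groupCohomology.H1 (cyclotomeRep (A := ViaUnits ρ) (⊤ : Subgroup P)) :=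
  (kummerVia ρ).comp (MonoidHom.toAdditive (unitsToInvariants ρ K hρ))

/-- `kummerEmbedding x = kummerVia (x ∈ (Ω^×)^{Π})`. [cite: LANA2026Report, §4.2 (b) p. 26] -/
theorem kummerEmbedding_apply (hρ : ρ.range ≤ K.fixingSubgroup) (x : (↥K)ˣ) :
    kummerEmbedding ρ K hρ (Additive.ofMul x) = kummerVia ρ (Additive.ofMul (unitsToInvariants ρ K hρ x)) := rfl

variable [IsGalois k Ω]

/-- **INJECTIVITY of `(Ω^×)^{Π} → H¹(Π, Λ(Ω^×))`** for `ρ(Π) = G_K` under `⋂_n (K^×)^n = 1`: a class vanishes iff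
its element has a compatible system of `Π`-invariant roots (L2-t3 `KummerKernel`); `Π`-invariant means in
`K^×` (`unitsEquivInvariants`), and such a system forces the element to be `1`.
[cite: LANA2026Report, §4.2 (b) p. 26, §6.1 p. 31] -/
theorem kummerVia_injective_of (hρ : ρ.range = K.fixingSubgroup) (h : DivisibleElementsTrivial (↥K)ˣ) :
    Function.Injective (kummerVia ρ) := by
  unfold kummerVia
  refine kummerMapFixed_injective_of_iInter_pow_eq_bot (A := ViaUnits ρ) ⊤ fun a ha => ?_
  obtain ⟨x, rfl⟩ := (unitsEquivInvariants ρ K hρ).surjective a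
  have hx : x = 1 := h.eq_one_of_forall_exists_pow x fun n hn => by
    obtain ⟨b, hb⟩ := ha ⟨n, hn⟩
    obtain ⟨y, rfl⟩ := (unitsEquivInvariants ρ K hρ).surjective b
    refine ⟨y, (unitsEquivInvariants ρ K hρ).injective ?_⟩
    rw [map_pow]
    exact hb
  rw [hx, map_one]

/-- **The embedding `K^× ↪ H¹(Π, Λ(Ω^×))` is injective** (`ρ(Π) = G_K`, `⋂_n (K^×)^n = 1`).
[cite: LANA2026Report, §4.2 (b) p. 26] -/
theorem kummerEmbedding_injective_of (hρ : ρ.range = K.fixingSubgroup) (h : DivisibleElementsTrivial (↥K)ˣ) :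
    Function.Injective (kummerEmbedding ρ K hρ.le) :=
  (kummerVia_injective_of ρ K hρ h).comp fun _ _ hab =>
    Additive.toMul.injective ((unitsToInvariants_injective ρ K hρ.le) (Additive.ofMul.injective hab))

/-- Hence `κ(x) = 0 ⟺ x = 1` on `K^×`. [cite: LANA2026Report, §4.2 (b) p. 26] -/
theorem kummerEmbedding_eq_zero_iff_of (hρ : ρ.range = K.fixingSubgroup) (h : DivisibleElementsTrivial (↥K)ˣ)
    (x : (↥K)ˣ) : kummerEmbedding ρ K hρ.le (Additive.ofMul x) = 0 ↔ x = 1 := by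
  constructor
  · intro h0
    have h1 : Additive.ofMul x = 0 := kummerEmbedding_injective_of ρ K hρ h (by rw [h0, map_zero])
    exact Additive.ofMul.injective h1
  · rintro rfl
    exact map_zero (kummerEmbedding ρ K hρ.le)

end Kummer

end Ambient

end IUTFork

end Summit.ABC

end
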